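import Mathlib
import Summits.Ventures.PercRepro2.UniversalSeriesBundlesSP

/-! # (UH*) on every series of bundles, all sizes
(seat mine-b, cell pub-perc-repro2; MINE-B.md §24)

The flow of `bundle k` is `k` (`SP.flow_bundle`) and the flow of a series is the minimum of its
bundles (`SP.flow_seriesBundles_le`), so a series of bundles with a bundle of `≤ 2` edges has flow
`≤ 2` and is covered by `SP.universal_of_flow_le_two`; every other series has all bundles of `≥ 3`
edges and is `SP.universal_seriesBundles`.  Together: **`SP.universal_seriesBundles_all`**, (UH*) on
every series of bundles, of any length and any sizes. -/

namespace Summit.Ventures.PercRepro2.V2Closure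

open Finset
open Summit.Ventures.PercRepro2.UHClosure

/-- the flow of a bundle is its number of edges -/
theorem SP.flow_bundle : ∀ k : ℕ, (SP.bundle k).flow = k
  | 0 => rfl
  | k + 1 => by
      show (SP.bundle k).flow + SP.free.flow = k + 1
      rw [SP.flow_bundle k]; rfl

/-- the flow of a series of bundles is below every bundle -/
theorem SP.flow_seriesBundles_le : ∀ (n : ℕ) (m : Fin (n + 1) → ℕ) (t : Fin (n + 1)),
    (SP.seriesBundles n m).flow ≤ m t
  | 0, m, t => by
      obtain rfl := Fin.fin_one_eq_zero t
      show (SP.bundle (m 0)).flow ≤ m 0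
      rw [SP.flow_bundle]
  | n + 1, m, t => by
      show min (SP.bundle (m 0)).flow (SP.seriesBundles n (fun j => m j.succ)).flow ≤ m t
      refine Fin.cases ?_ (fun j => ?_) t
      · rw [SP.flow_bundle]; exact min_le_left _ _
      · exact le_trans (min_le_right _ _) (SP.flow_seriesBundles_le n (fun j => m j.succ) j)

/-- **THEOREM: (UH*) holds on every series of bundles `bundle (m 0) ∧ … ∧ bundle (m n)`, of any
length and any sizes.** -/
theorem SP.universal_seriesBundles_all (n : ℕ) (m : Fin (n + 1) → ℕ) :
    Universal (SP.seriesBundles n m).rLab (SP.seriesBundles n m).bLab := by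
  by_cases hm : ∀ t, 3 ≤ m t
  · exact SP.universal_seriesBundles n m hm
  · obtain ⟨t, ht⟩ : ∃ t, m t < 3 := by
      by_contra h
      exact hm (fun t => by by_contra h'; exact h ⟨t, by omega⟩)
    apply SP.universal_of_flow_le_two
    have := SP.flow_seriesBundles_le n m t
    omega

end Summit.Ventures.PercRepro2.V2Closure
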